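import Summits.KontsevichZagierPeriods.KontsevichZagierPeriods.Theorems.SoloInformedDensityAdd
import Summits.KontsevichZagierPeriods.KontsevichZagierPeriods.Theorems.SoloInformedCADCells
import HarnessLib
import HarnessLib.Audit

/-!
# SoloInformed — bands, shears and finite scissors splits (tools for PROPOSITION 5.1 of `planar-cauchy.md`)

Solo programme `solo-KontsevichZagierPeriods-informed`, session s248 (file 1 of 2; file 2 is
`SoloInformedH3FromEquidim`).

Tools, all inside `𝒮 = soloInformedScissorsRel` (generated by scissors moves and volume-preserving
`ℚ`-semialgebraic `C¹` maps between volume representations):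

* `soloInformed_volume_domain_lt_top_of_isVolRep` — a volume representation has finite volume;
* `soloInformed_of_sub_sum_of_mem_scissorsRel`, `…_cells_…`, `…_openCells_…` — finite scissors
  splits, in particular along the (open) cells of a cylindrical decomposition adapted to the domain;
* `soloInformed_volume_bandOver_eq_top` — the lowest and the highest band of a stack over a
  nonempty open cell have infinite volume (so finite-volume open cells are bands between two
  finite sections);
* `soloInformed_exists_shear_of_under` — the shear `(x,t) ↦ (x, t + f x)` maps the region `U(c)`
  under the graph of `q = c.integrand` onto the closed band `{f ≤ t ≤ f + q}` by a volume-preserving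
  map move (`mapGen`);
* `soloInformed_value_under_of_nonneg` — `vol U(c) = ∫ q` for `q ≥ 0` (Newton–Leibniz).
-/

noncomputable section

open scoped BigOperators Topology ContDiff

namespace Summit.KontsevichZagierPeriods.KontsevichZagierPeriods.Theorems

open Set MeasureTheory Filter
open Literature.ModelTheory.ExponentialFields
open Literature.NumberTheory.Transcendental Literature.NumberTheory.Transcendental.KZ

variable {n : ℕ}

/-! ### Volume representations have finite volume -/

/-- The domain of a volume representation has finite volume (its integrand `1` is integrable).
[folklore] -/
theorem soloInformed_volume_domain_lt_top_of_isVolRep {m : ℕ} {A : IntegralRep m}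
    (hA : SoloInformedIsVolRep A) : volume A.domain < ⊤ := by
  have hi : IntegrableOn (fun _ => (1 : ℝ)) A.domain volume :=
    A.integrableOn.congr_fun (fun x hx => hA x hx) (IntegralRep.measurableSet_domain_holds A)
  have h2 := hi.hasFiniteIntegral
  rw [hasFiniteIntegral_iff_enorm] at h2
  simpa only [enorm_one, lintegral_const, Measure.restrict_apply_univ, one_mul] using h2

/-! ### Scissors splitting along finitely many pieces -/

/-- **Finite scissors split.** If the domain of a volume representation `r` is the union of the
domains of volume representations `ρ i` (`i ∈ S`) with pairwise null overlaps, then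
`[r] − ∑ [ρ i] ∈ 𝒮`. [this work] -/
theorem soloInformed_of_sub_sum_of_mem_scissorsRel {ι : Type*} (S : Finset ι)
    (ρ : ι → IntegralRep n) (r : IntegralRep n) (hr : SoloInformedIsVolRep r)
    (hρ : ∀ i ∈ S, SoloInformedIsVolRep (ρ i))
    (hcover : r.domain = ⋃ i ∈ S, (ρ i).domain)
    (hnull : ∀ i ∈ S, ∀ j ∈ S, i ≠ j → volume ((ρ i).domain ∩ (ρ j).domain) = 0) :
    of r - ∑ i ∈ S, of (ρ i) ∈ soloInformedScissorsRel := by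
  classical
  induction S using Finset.induction_on generalizing r with
  | empty =>
    rw [Finset.sum_empty, sub_zero]
    refine soloInformed_of_mem_scissorsRel_of_volume_eq_zero hr ?_
    rw [hcover]
    simp
  | insert a S ha ih =>
    set U : Set (Fin n → ℝ) := ⋃ i ∈ S, (ρ i).domain with hU
    have hUsa : IsSemialgebraic ℚ U :=
      IsSemialgebraic.biUnion S (fun i => (ρ i).domain) fun i _ => (ρ i).isSemialgebraic_domain
    have hcover' : r.domain = (ρ a).domain ∪ U := by rw [hcover, Finset.set_biUnion_insert]
    have hUsub : U ⊆ r.domain := by rw [hcover']; exact subset_union_right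
    have hnull' : volume ((ρ a).domain ∩ U) = 0 := by
      rw [hU, inter_iUnion₂]
      refine (measure_biUnion_null_iff S.countable_toSet).2 fun i hi => ?_
      exact hnull a (Finset.mem_insert_self a S) i (Finset.mem_insert_of_mem hi)
        (fun h => ha (h ▸ hi))
    set rU : IntegralRep n := soloInformedRestrict r hUsa hUsub with hrU
    have hrUvol : SoloInformedIsVolRep rU := fun x hx => hr x (hUsub hx)
    have h1 : of r - of (ρ a) - of rU ∈ soloInformedScissorsRel :=
      soloInformed_scissorsGen_subset_scissorsRel
        (soloInformed_mem_scissorsGen hr (hρ a (Finset.mem_insert_self a S)) hrUvol hcover' hnull')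
    have h2 : of rU - ∑ i ∈ S, of (ρ i) ∈ soloInformedScissorsRel :=
      ih rU hrUvol (fun i hi => hρ i (Finset.mem_insert_of_mem hi)) rfl
        (fun i hi j hj hij => hnull i (Finset.mem_insert_of_mem hi) j
          (Finset.mem_insert_of_mem hj) hij)
    rw [Finset.sum_insert ha]
    have e : of r - (of (ρ a) + ∑ i ∈ S, of (ρ i)) =
        (of r - of (ρ a) - of rU) + (of rU - ∑ i ∈ S, of (ρ i)) := by abel
    rw [e]
    exact add_mem h1 h2

/-- **Splitting along the cells of a CAD, in `𝒮`.** [this work] -/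
theorem soloInformed_of_sub_sum_cells_mem_scissorsRel {𝒯 : Finset (Set (Fin n → ℝ))}
    (h𝒯 : IsCylindricalDecomposition ℚ n 𝒯) {r : IntegralRep n} (hr : SoloInformedIsVolRep r)
    {𝒞 : Finset (Set (Fin n → ℝ))} (h𝒞 : 𝒞 ⊆ 𝒯)
    (hcover : ⋃₀ (𝒞 : Set (Set (Fin n → ℝ))) = r.domain) :
    of r - ∑ C ∈ 𝒞, of (soloInformedCadRep r C) ∈ soloInformedScissorsRel := by
  have hsa : ∀ C ∈ 𝒞, IsSemialgebraic ℚ C := fun C hC => h𝒯.isSemialgebraic C (h𝒞 hC)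
  have hsub : ∀ C ∈ 𝒞, C ⊆ r.domain := fun C hC => hcover ▸ subset_sUnion_of_mem hC
  have hdom : ∀ C ∈ 𝒞, (soloInformedCadRep r C).domain = C := fun C hC =>
    soloInformed_cadRep_domain r (hsa C hC) (hsub C hC)
  refine soloInformed_of_sub_sum_of_mem_scissorsRel 𝒞 (soloInformedCadRep r) r hr ?_ ?_ ?_
  · intro C hC x hx
    rw [soloInformed_cadRep_integrand]
    rw [hdom C hC] at hx
    exact hr x (hsub C hC hx)
  · rw [← hcover, sUnion_eq_biUnion]
    exact iUnion₂_congr fun C hC => (hdom C hC).symm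
  · intro C hC C' hC' hne
    rw [hdom C hC, hdom C' hC']
    have hdisj : Disjoint C C' := h𝒯.isPartition.pairwiseDisjoint (h𝒞 hC) (h𝒞 hC') hne
    rw [hdisj.inter_eq, measure_empty]

open Classical in
/-- **Splitting along the open cells of a CAD, in `𝒮`** (the other cells are null).
[this work] -/
theorem soloInformed_of_sub_sum_openCells_mem_scissorsRel {𝒯 : Finset (Set (Fin n → ℝ))}
    (h𝒯 : IsCylindricalDecomposition ℚ n 𝒯) {r : IntegralRep n} (hr : SoloInformedIsVolRep r)
    {𝒞 : Finset (Set (Fin n → ℝ))} (h𝒞 : 𝒞 ⊆ 𝒯)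
    (hcover : ⋃₀ (𝒞 : Set (Set (Fin n → ℝ))) = r.domain) :
    of r - ∑ C ∈ 𝒞.filter IsOpen, of (soloInformedCadRep r C) ∈ soloInformedScissorsRel := by
  have h1 := soloInformed_of_sub_sum_cells_mem_scissorsRel h𝒯 hr h𝒞 hcover
  rw [← Finset.sum_filter_add_sum_filter_not 𝒞 IsOpen] at h1
  have h2 : ∑ C ∈ 𝒞.filter (fun C => ¬IsOpen C), of (soloInformedCadRep r C) ∈
      soloInformedScissorsRel := by
    refine AddSubgroup.sum_mem _ fun C hC => ?_
    rw [Finset.mem_filter] at hC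
    have hCsub : C ⊆ r.domain := hcover ▸ subset_sUnion_of_mem hC.1
    have hCsa : IsSemialgebraic ℚ C := h𝒯.isSemialgebraic C (h𝒞 hC.1)
    refine soloInformed_of_mem_scissorsRel_of_volume_eq_zero (r := soloInformedCadRep r C) ?_ ?_
    · intro x hx
      rw [soloInformed_cadRep_integrand]
      rw [soloInformed_cadRep_domain r hCsa hCsub] at hx
      exact hr x (hCsub hx)
    · rw [soloInformed_cadRep_domain r hCsa hCsub]
      exact soloInformed_cad_volume_eq_zero_of_not_isOpen h𝒯 (h𝒞 hC.1) hC.2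
  have h3 := add_mem h1 h2
  rwa [sub_add_eq_sub_sub, sub_add_cancel] at h3

/-! ### Unbounded bands have infinite volume -/

/-- A slice `B × I` of a cylinder, with `vol B ≠ 0` and `vol I = ∞`, has infinite volume.
[folklore] -/
theorem soloInformed_volume_cylinderSlice_eq_top {B : Set (Fin n → ℝ)} (hB : MeasurableSet B)
    (hB0 : volume B ≠ 0) {I : Set ℝ} (hI : MeasurableSet I) (hItop : volume I = ⊤) :
    volume {z : Fin (n + 1) → ℝ | Fin.init z ∈ B ∧ z (Fin.last n) ∈ I} = ⊤ := by
  set e : (Fin (n + 1) → ℝ) ≃ᵐ ℝ × (Fin n → ℝ) :=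
    MeasurableEquiv.piFinSuccAbove (fun _ => ℝ) (Fin.last n) with he_def
  have he : MeasurePreserving e volume volume :=
    volume_preserving_piFinSuccAbove (fun _ => ℝ) (Fin.last n)
  have he1 : ∀ z : Fin (n + 1) → ℝ, (e z).1 = z (Fin.last n) := fun z => by
    simp [he_def, MeasurableEquiv.piFinSuccAbove]
  have he2 : ∀ z : Fin (n + 1) → ℝ, (e z).2 = Fin.init z := fun z => by
    ext i
    simp [he_def, MeasurableEquiv.piFinSuccAbove, Fin.init]
  have hset : {z : Fin (n + 1) → ℝ | Fin.init z ∈ B ∧ z (Fin.last n) ∈ I} = e ⁻¹' (I ×ˢ B) := by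
    ext z
    simp only [mem_setOf_eq, mem_preimage, mem_prod, he1, he2]
    tauto
  rw [hset, he.measure_preimage (hI.prod hB).nullMeasurableSet, Measure.volume_eq_prod,
    Measure.prod_prod, hItop, ENNReal.top_mul hB0]

/-- **The lowest and the highest band of a stack over a nonempty open cell have infinite volume**
(they contain a half-cylinder over a ball). [folklore; Basu–Pollack–Roy 2006, §5.1] -/
theorem soloInformed_volume_bandOver_eq_top {S : Set (Fin n → ℝ)} (hSo : IsOpen S)
    (hne : S.Nonempty) {l : ℕ} {ξ : Fin l → (Fin n → ℝ) → ℝ} (hξ : ∀ i, ContinuousOn (ξ i) S)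
    {j : Fin (l + 1)} (hj : j = 0 ∨ j = Fin.last l) : volume (bandOver S ξ j) = ⊤ := by
  obtain ⟨x₀, hx₀⟩ := hne
  have hev : ∀ᶠ x in 𝓝 x₀, x ∈ S ∧ ∀ i, ξ i x ∈ Ioo (ξ i x₀ - 1) (ξ i x₀ + 1) := by
    refine (hSo.eventually_mem hx₀).and (eventually_all.2 fun i => ?_)
    have hc : ContinuousAt (ξ i) x₀ := (hξ i).continuousAt (hSo.mem_nhds hx₀)
    exact hc.eventually (Ioo_mem_nhds (by linarith) (by linarith))
  obtain ⟨ε, hε, hball⟩ := Metric.eventually_nhds_iff_ball.1 hev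
  have hBm : MeasurableSet (Metric.ball x₀ ε) := Metric.isOpen_ball.measurableSet
  have hB0 : volume (Metric.ball x₀ ε) ≠ 0 := (Metric.measure_ball_pos volume x₀ hε).ne'
  cases l with
  | zero =>
    have hj0 : j = 0 := Fin.ext (by have := j.isLt; omega)
    subst hj0
    refine measure_mono_top (fun z hz => ?_)
      (soloInformed_volume_cylinderSlice_eq_top (I := Iio 0) hBm hB0 measurableSet_Iio Real.volume_Iio)
    obtain ⟨hzB, -⟩ := hz
    rw [mem_bandOver_iff]
    refine ⟨(hball _ hzB).1, ?_, ?_⟩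
    · rw [bandLower_zero]; exact EReal.bot_lt_coe _
    · rw [show (0 : Fin (0 + 1)) = Fin.last 0 from rfl, bandUpper_last]; exact EReal.coe_lt_top _
  | succ k =>
    rcases hj with rfl | rfl
    · refine measure_mono_top (fun z hz => ?_)
        (soloInformed_volume_cylinderSlice_eq_top (I := Iio (ξ 0 x₀ - 1)) hBm hB0 measurableSet_Iio
          Real.volume_Iio)
      obtain ⟨hzB, hzm⟩ := hz
      rw [mem_bandOver_iff]
      refine ⟨(hball _ hzB).1, ?_, ?_⟩
      · rw [bandLower_zero]; exact EReal.bot_lt_coe _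
      · rw [bandUpper_zero, EReal.coe_lt_coe_iff]
        exact lt_trans hzm ((hball _ hzB).2 0).1
    · refine measure_mono_top (fun z hz => ?_)
        (soloInformed_volume_cylinderSlice_eq_top (I := Ioi (ξ (Fin.last k) x₀ + 1)) hBm hB0
          measurableSet_Ioi Real.volume_Ioi)
      obtain ⟨hzB, hzm⟩ := hz
      rw [mem_bandOver_iff]
      refine ⟨(hball _ hzB).1, ?_, ?_⟩
      · rw [bandLower_last, EReal.coe_lt_coe_iff]
        exact lt_trans ((hball _ hzB).2 (Fin.last k)).2 hzm
      · rw [bandUpper_last]; exact EReal.coe_lt_top _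

/-! ### The shear of a band onto the region under a graph -/

/-- **Shear.** For `c = [σ, q]` and a `ℚ`-semialgebraic `f` differentiable on `σ`, the shear
`(x, t) ↦ (x, t + f x)` is a volume-preserving `ℚ`-semialgebraic `C¹` map of `U(c)` onto the closed
band `{x ∈ σ, f x ≤ t ≤ f x + q x}`; the latter, with integrand `1`, is a volume representation `M`
with `[U(c)] − [M] ∈ mapGen`. [this work; cf. `soloInformed_under_stack_mem_scissorsRel`] -/
theorem soloInformed_exists_shear_of_under (c : IntegralRep n) {f : (Fin n → ℝ) → ℝ}
    {f' : (Fin n → ℝ) → (Fin n → ℝ) →L[ℝ] ℝ} (hfsa : IsSemialgebraicFunOn ℚ c.domain f)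
    (hfd : ∀ x ∈ c.domain, HasFDerivAt f (f' x) x) :
    ∃ M : IntegralRep (n + 1), SoloInformedIsVolRep M ∧
      M.domain = {w : Fin (n + 1) → ℝ | Fin.init w ∈ c.domain ∧ f (Fin.init w) ≤ w (Fin.last n) ∧
        w (Fin.last n) ≤ f (Fin.init w) + c.integrand (Fin.init w)} ∧
      of (soloInformedUnder c) - of M ∈ soloInformedMapGen := by
  have hS : ∀ z, z ∈ (soloInformedUnder c).domain ↔ Fin.init z ∈ c.domain ∧ 0 ≤ z (Fin.last n) ∧
      z (Fin.last n) ≤ c.integrand (Fin.init z) := fun z => soloInformed_mem_under_domain c z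
  set Gs : (Fin (n + 1) → ℝ) → ℝ := fun z => z (Fin.last n) + f (Fin.init z) with hGs_def
  set φ : (Fin (n + 1) → ℝ) → (Fin (n + 1) → ℝ) →L[ℝ] ℝ :=
    fun z => soloInformedStackShearDeriv (f' (Fin.init z)) with hφ_def
  have hG : IsSemialgebraicFunOn ℚ (soloInformedUnder c).domain Gs := by
    have h1 : IsSemialgebraicFunOn ℚ (soloInformedUnder c).domain (fun z => z (Fin.last n)) :=
      isSemialgebraicFunOn_apply (soloInformedUnder c).isSemialgebraic_domain (Fin.last n)
    have h2 : IsSemialgebraicFunOn ℚ (soloInformedUnder c).domain (fun z => f (Fin.init z)) :=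
      hfsa.comp_init.mono (fun z hz => ((hS z).mp hz).1) (soloInformedUnder c).isSemialgebraic_domain
    exact IsSemialgebraicFunOn.add_holds h1 h2
  have hd : ∀ z ∈ (soloInformedUnder c).domain,
      HasFDerivWithinAt Gs (φ z) (soloInformedUnder c).domain z := fun z hz =>
    (soloInformed_hasFDerivAt_stackShear (hfd _ ((hS z).mp hz).1)).hasFDerivWithinAt
  have hinj : InjOn (soloInformedLastSubst Gs) (soloInformedUnder c).domain :=
    soloInformed_injOn_lastSubst_of_strictMono fun z _ z' _ hi hlt => by
      show z (Fin.last n) + f (Fin.init z) < z' (Fin.last n) + f (Fin.init z')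
      rw [hi]
      linarith
  have hjac : ∀ z ∈ (soloInformedUnder c).domain,
      (soloInformedUnder c).integrand z = |φ z (Pi.single (Fin.last n) 1)| := fun z _ => by
    rw [soloInformed_under_integrand, hφ_def, soloInformed_stackShearDeriv_single, abs_one]
  set M := soloInformedLastSubstRep (soloInformedUnder c) Gs φ hG hd hinj hjac with hM_def
  have hMvol : SoloInformedIsVolRep M := fun w _ =>
    soloInformed_lastSubstRep_integrand _ _ _ hG hd hinj hjac w
  have hMdom : M.domain = {w : Fin (n + 1) → ℝ | Fin.init w ∈ c.domain ∧
      f (Fin.init w) ≤ w (Fin.last n) ∧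
      w (Fin.last n) ≤ f (Fin.init w) + c.integrand (Fin.init w)} := by
    rw [hM_def, soloInformed_lastSubstRep_domain]
    ext w
    constructor
    · rintro ⟨z, hz, rfl⟩
      obtain ⟨hx, h0, hq⟩ := (hS z).mp hz
      refine ⟨?_, ?_, ?_⟩
      · rw [soloInformed_init_lastSubst]; exact hx
      · rw [soloInformed_init_lastSubst, soloInformed_lastSubst_apply_last]
        show f (Fin.init z) ≤ z (Fin.last n) + f (Fin.init z)
        linarith
      · rw [soloInformed_init_lastSubst, soloInformed_lastSubst_apply_last]
        show z (Fin.last n) + f (Fin.init z) ≤ _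
        linarith
    · rintro ⟨hx, h1, h2⟩
      refine ⟨Fin.snoc (Fin.init w) (w (Fin.last n) - f (Fin.init w)), (hS _).mpr ?_, ?_⟩
      · simp only [Fin.init_snoc, Fin.snoc_last]
        exact ⟨hx, by linarith, by linarith⟩
      · rw [soloInformed_lastSubst_eq_snoc]
        simp only [hGs_def, Fin.init_snoc, Fin.snoc_last, sub_add_cancel, Fin.snoc_init_self]
  exact ⟨M, hMvol, hMdom, n + 1, n + 1, soloInformedUnder c, M, rfl, soloInformed_isVolRep_under c,
    hMvol, soloInformed_of_sub_of_lastSubstRep_mem_changeOfVariablesRel _ _ _ hG hd hinj hjac, rfl⟩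

/-! ### The value of the region under a graph -/

/-- **Newton–Leibniz for `U(c)`**: `[U(c)] − [c] ∈ newtonLeibnizRel` for `c` with integrand `≥ 0`
(antiderivative `F(x,t) = t`). [Kontsevich–Zagier 2001, §1.2 rule (3)] -/
theorem soloInformed_of_under_sub_of_mem_newtonLeibnizRel (c : IntegralRep n)
    (hc0 : ∀ x ∈ c.domain, 0 ≤ c.integrand x) :
    of (soloInformedUnder c) - of c ∈ newtonLeibnizRel := by
  have hF : IsSemialgebraicFunOn ℚ (soloInformedUnder c).domain
      (fun z : Fin (n + 1) → ℝ => z (Fin.last n)) :=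
    isSemialgebraicFunOn_apply (soloInformedUnder c).isSemialgebraic_domain (Fin.last n)
  have h0 : IsSemialgebraicFunOn ℚ c.domain (fun _ => (0 : ℝ)) := by
    simpa using isSemialgebraicFunOn_ratCast c.isSemialgebraic_domain 0
  refine ⟨n, soloInformedUnder c, c, fun _ => 0, c.integrand, fun z => z (Fin.last n), hF, h0,
    c.isSemialgebraicFunOn_integrand, hc0, ?_, ?_, ?_, ?_, rfl⟩
  · ext z
    exact soloInformed_mem_under_domain c z
  · intro x _
    simp only [Fin.snoc_last]
    exact continuousOn_id
  · intro x _ t _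
    simp only [Fin.snoc_last, soloInformed_under_integrand]
    exact hasDerivAt_id t
  · intro x _
    simp only [Fin.snoc_last, sub_zero]

/-- `vol U(c) = ∫_σ q` for `c = [σ, q]` with `q ≥ 0`. [Kontsevich–Zagier 2001, §1.2] -/
theorem soloInformed_value_under_of_nonneg (c : IntegralRep n)
    (hc0 : ∀ x ∈ c.domain, 0 ≤ c.integrand x) : (soloInformedUnder c).value = c.value :=
  Equivalent.value_eq_holds
    (newtonLeibnizRel_subset_relations (soloInformed_of_under_sub_of_mem_newtonLeibnizRel c hc0))

end Summit.KontsevichZagierPeriods.KontsevichZagierPeriods.Theorems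

end
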